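import Summits.NavierStokesRegularity.NavierStokesRegularity.Theorems.GaldiLiouvilleGateRecordZoomAncientStubZoomLimit
import Literature.Analysis.FluidPDE.JiaSverak2013Lemma8SliceTools
import HarnessLib

/-!
# Route `GaldiLiouvilleGate`, crux `RecordZoomAncient` (stmt-NavierStokesRegularity-0894),
  line `registered` (birth skeleton, reshape r7) — stub `stub_cutoffEnstrophy`

**Statement.** There is a constant `c > 0` such that: if `C¹` fields `f n : ℝ³ → ℝ³` with
`‖f n‖ ≤ 1` converge pointwise to a `C¹` field `fl`, and for every radius `R > 0`, eventually in
`n`, `∫_{B(0,R)} |∇f n|² ≤ D` and `∫_{B(0,R)} ‖f n‖⁶ ≤ D₆` (`D, D₆ ≥ 0`), then the limit has finite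
GLOBAL Dirichlet energy `∫ |∇fl|² ≤ 2D + c D₆^{1/3}`.

**Proof (cut-off, Hölder on the ball, lower semicontinuity, exhaustion).** Let `χ_R = χ(·/R)` be
the tree's smooth cut-off (`Literature.Analysis.FluidPDE.cutoff R`: `= 1` on `B̄(0,R)`, supported
in `B̄(0,2R)`, values in `[0,1]`, `‖∇χ_R‖ ≤ c'/R`, `exists_norm_fderiv_cutoff_le`). For a `C¹`
field `g`, Leibniz and `|a A + φ ⊗ z|² ≤ 2a²|A|² + 6‖φ‖²‖z‖²`
(`frobeniusNormSq_smul_add_smulRight_le_six`) give, pointwise,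
`|∇(χ_R g)|² ≤ 2|∇g|² + 6 (c'/R)² ‖g‖²`, and `∇(χ_R g) = 0` off `B(0,3R)`; hence
`∫ |∇(χ_R g)|² ≤ 2 ∫_{B(0,3R)} |∇g|² + 6 (c'/R)² ∫_{B(0,3R)} ‖g‖²`, and by Hölder
`∫_{B(0,3R)} ‖g‖² ≤ (∫_{B(0,3R)} ‖g‖⁶)^{1/3} |B(0,3R)|^{2/3} = 9R² |B(0,1)|^{2/3} (∫ ‖g‖⁶)^{1/3}`:
the powers of `R` cancel. Applied to the tail `g = f (k + N)` (with `N` from the two eventual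
hypotheses at radius `3R`) this is the uniform bound `2D + 54 c'² |B(0,1)|^{2/3} D₆^{1/3}` for the
`C¹` fields `χ_R f (k + N)`, bounded by `1` and converging pointwise to `χ_R fl`; the tree's lower
semicontinuity lemma `lintegral_frobeniusNormSq_fderiv_le_of_tendsto_of_bound` transfers it to
`∫ |∇(χ_R fl)|² ≥ ∫_{B(0,R)} |∇fl|²` (`χ_R = 1` on the open ball). Finally
`∫ |∇fl|² = sup_n ∫_{B(0,n+1)} |∇fl|²` (`setLIntegral_iUnion_of_directed`).
-/

noncomputable section

open Set MeasureTheory Filter Topology Function Literature.Analysis.FluidPDE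
open scoped ENNReal NNReal

namespace Summit.NavierStokesRegularity.NavierStokesRegularity.Theorems.RecordZoomAncient.Birth

-- the problem-side namespace `Summit.NavierStokesRegularity.NavierStokesRegularity.…` (summit =
-- problem for this single-problem summit) duplicates `NavierStokesRegularity` by design
set_option linter.dupNamespace false

/-- **Leibniz bound for the cut-off field.** If `‖∇χ_R‖ ≤ C/R`, then for a differentiable `g`,
pointwise, `|∇(χ_R g)|² ≤ 2|∇g|² + 6 (C/R)² ‖g‖²` (`0 ≤ χ_R ≤ 1`). -/
theorem cutoffEnstrophy_frobeniusNormSq_fderiv_smul_le {C R : ℝ}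
    (hC : ∀ x : EuclideanSpace ℝ (Fin 3), ‖fderiv ℝ (cutoff R) x‖ ≤ C / R)
    {g : EuclideanSpace ℝ (Fin 3) → EuclideanSpace ℝ (Fin 3)} (hg : Differentiable ℝ g)
    (x : EuclideanSpace ℝ (Fin 3)) :
    frobeniusNormSq (fderiv ℝ (fun y => cutoff R y • g y) x) ≤
      2 * frobeniusNormSq (fderiv ℝ g x) + 6 * (C / R) ^ 2 * ‖g x‖ ^ 2 := by
  rw [fderiv_fun_smul ((contDiff_cutoff (n := 1) R).differentiable (by simp) x) (hg x)]
  have h := frobeniusNormSq_smul_add_smulRight_le_six (cutoff R x) (fderiv ℝ g x)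
    (fderiv ℝ (cutoff R) x) (g x)
  have h0 := cutoff_nonneg R x
  have h1 := cutoff_le_one R x
  have hsq : cutoff R x ^ 2 ≤ 1 := by nlinarith
  have h2 : ‖fderiv ℝ (cutoff R) x‖ ^ 2 ≤ (C / R) ^ 2 := pow_le_pow_left₀ (norm_nonneg _) (hC x) 2
  have hF := frobeniusNormSq_nonneg (fderiv ℝ g x)
  have h3 := mul_le_mul_of_nonneg_right hsq hF
  have h4 := mul_le_mul_of_nonneg_right h2 (sq_nonneg ‖g x‖)
  nlinarith

/-- Off the ball `B(0, 2R)` the cut-off field `χ_R g` is locally zero, so its derivative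
vanishes. -/
theorem cutoffEnstrophy_fderiv_smul_eq_zero {R : ℝ} (hR : 0 < R)
    (g : EuclideanSpace ℝ (Fin 3) → EuclideanSpace ℝ (Fin 3)) {x : EuclideanSpace ℝ (Fin 3)}
    (hx : 2 * R < ‖x‖) : fderiv ℝ (fun y => cutoff R y • g y) x = 0 := by
  apply fderiv_of_notMem_tsupport ℝ
  intro hmem
  have h2 := tsupport_cutoff_subset hR (tsupport_smul_subset_left (cutoff R) g hmem)
  rw [Metric.mem_closedBall, dist_zero_right] at h2
  linarith

/-- On the open ball `B(0, R)` the cut-off field `χ_R g` agrees with `g` near every point, so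
the derivatives coincide. -/
theorem cutoffEnstrophy_fderiv_smul_eq_of_mem_ball {R : ℝ} (hR : 0 < R)
    (g : EuclideanSpace ℝ (Fin 3) → EuclideanSpace ℝ (Fin 3)) {x : EuclideanSpace ℝ (Fin 3)}
    (hx : x ∈ Metric.ball 0 R) :
    fderiv ℝ (fun y => cutoff R y • g y) x = fderiv ℝ g x := by
  apply Filter.EventuallyEq.fderiv_eq
  filter_upwards [Metric.isOpen_ball.mem_nhds hx] with y hy
  rw [cutoff_eq_one hR (mem_ball_zero_iff.1 hy).le, one_smul]

/-- **Enstrophy of the cut-off field**: `∫ |∇(χ_R g)|² ≤ 2 ∫_{B(0,3R)} |∇g|² +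
6 (C/R)² ∫_{B(0,3R)} ‖g‖²` for a `C¹` field `g` and `‖∇χ_R‖ ≤ C/R`. -/
theorem cutoffEnstrophy_lintegral_fderiv_smul_le {C R : ℝ} (hR : 0 < R)
    (hC : ∀ x : EuclideanSpace ℝ (Fin 3), ‖fderiv ℝ (cutoff R) x‖ ≤ C / R)
    {g : EuclideanSpace ℝ (Fin 3) → EuclideanSpace ℝ (Fin 3)} (hg : ContDiff ℝ 1 g) :
    ∫⁻ x, ENNReal.ofReal (frobeniusNormSq (fderiv ℝ (fun y => cutoff R y • g y) x)) ≤
      (2 * ∫⁻ x in Metric.ball (0 : EuclideanSpace ℝ (Fin 3)) (3 * R),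
          ENNReal.ofReal (frobeniusNormSq (fderiv ℝ g x))) +
        ENNReal.ofReal (6 * (C / R) ^ 2) *
          ∫⁻ x in Metric.ball (0 : EuclideanSpace ℝ (Fin 3)) (3 * R), ‖g x‖ₑ ^ 2 := by
  set B : Set (EuclideanSpace ℝ (Fin 3)) := Metric.ball 0 (3 * R) with hB
  set G : EuclideanSpace ℝ (Fin 3) → ℝ≥0∞ := fun x =>
    2 * ENNReal.ofReal (frobeniusNormSq (fderiv ℝ g x)) +
      ENNReal.ofReal (6 * (C / R) ^ 2) * ‖g x‖ₑ ^ 2 with hG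
  have hpt : ∀ x, ENNReal.ofReal (frobeniusNormSq (fderiv ℝ (fun y => cutoff R y • g y) x)) ≤
      B.indicator G x := by
    intro x
    by_cases hx : x ∈ B
    · rw [indicator_of_mem hx]
      calc ENNReal.ofReal (frobeniusNormSq (fderiv ℝ (fun y => cutoff R y • g y) x))
          ≤ ENNReal.ofReal (2 * frobeniusNormSq (fderiv ℝ g x) + 6 * (C / R) ^ 2 * ‖g x‖ ^ 2) :=
            ENNReal.ofReal_le_ofReal
              (cutoffEnstrophy_frobeniusNormSq_fderiv_smul_le hC (hg.differentiable one_ne_zero) x)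
        _ = G x := by
            rw [hG, ENNReal.ofReal_add (mul_nonneg zero_le_two (frobeniusNormSq_nonneg _))
              (by positivity), ENNReal.ofReal_mul zero_le_two, ENNReal.ofReal_ofNat,
              ENNReal.ofReal_mul (by positivity), ENNReal.ofReal_pow (norm_nonneg _), ofReal_norm]
    · rw [indicator_of_notMem hx]
      have hx' : 2 * R < ‖x‖ := by
        rw [hB, Metric.mem_ball, dist_zero_right, not_lt] at hx
        linarith
      rw [cutoffEnstrophy_fderiv_smul_eq_zero hR g hx', frobeniusNormSq_zero, ENNReal.ofReal_zero]
  have hmeas : AEMeasurable (fun x => ENNReal.ofReal (6 * (C / R) ^ 2) * ‖g x‖ₑ ^ 2)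
      (volume.restrict B) :=
    (((hg.continuous.measurable.enorm).pow_const 2).const_mul _).aemeasurable
  calc ∫⁻ x, ENNReal.ofReal (frobeniusNormSq (fderiv ℝ (fun y => cutoff R y • g y) x))
      ≤ ∫⁻ x, B.indicator G x := lintegral_mono hpt
    _ = ∫⁻ x in B, G x := lintegral_indicator Metric.isOpen_ball.measurableSet _
    _ = _ := by
        rw [hG, lintegral_add_right' _ hmeas, lintegral_const_mul' _ _ ENNReal.ofNat_ne_top,
          lintegral_const_mul' _ _ ENNReal.ofReal_ne_top]

/-- **Hölder on a set**: `∫_s ‖g‖² ≤ (∫_s ‖g‖⁶)^{1/3} |s|^{2/3}` for a continuous field `g`. -/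
theorem cutoffEnstrophy_setLIntegral_enorm_sq_le (s : Set (EuclideanSpace ℝ (Fin 3)))
    {g : EuclideanSpace ℝ (Fin 3) → EuclideanSpace ℝ (Fin 3)} (hg : Continuous g) :
    ∫⁻ x in s, ‖g x‖ₑ ^ 2 ≤ (∫⁻ x in s, ‖g x‖ₑ ^ 6) ^ (1 / 3 : ℝ) * volume s ^ (2 / 3 : ℝ) := by
  have hpq : (3 : ℝ).HolderConjugate (3 / 2) :=
    Real.holderConjugate_iff.2 ⟨by norm_num, by norm_num⟩
  have hm : AEMeasurable (fun x => ‖g x‖ₑ ^ 2) (volume.restrict s) :=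
    ((hg.measurable.enorm).pow_const 2).aemeasurable
  have h := ENNReal.lintegral_mul_le_Lp_mul_Lq (volume.restrict s) hpq hm
    (aemeasurable_const (b := (1 : ℝ≥0∞)))
  have e1 : ∀ a : EuclideanSpace ℝ (Fin 3), ((‖g a‖ₑ ^ 2) ^ (3 : ℝ) : ℝ≥0∞) = ‖g a‖ₑ ^ 6 :=
    fun a => by rw [show (3 : ℝ) = ((3 : ℕ) : ℝ) by norm_num, ENNReal.rpow_natCast, ← pow_mul]
  simp only [Pi.mul_apply, mul_one, ENNReal.one_rpow, lintegral_const, Measure.restrict_apply_univ,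
    e1] at h
  calc ∫⁻ x in s, ‖g x‖ₑ ^ 2 ≤ _ := h
    _ = _ := by norm_num

/-- **The powers of `R` cancel**: `6 (C/R)² |B(0,3R)|^{2/3} = 54 C² |B(0,1)|^{2/3}`. -/
theorem cutoffEnstrophy_const_eq (C : ℝ) {R : ℝ} (hR : 0 < R) :
    ENNReal.ofReal (6 * (C / R) ^ 2) *
        volume (Metric.ball (0 : EuclideanSpace ℝ (Fin 3)) (3 * R)) ^ (2 / 3 : ℝ) =
      ENNReal.ofReal (54 * C ^ 2) *
        volume (Metric.ball (0 : EuclideanSpace ℝ (Fin 3)) 1) ^ (2 / 3 : ℝ) := by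
  rw [Measure.addHaar_ball volume (0 : EuclideanSpace ℝ (Fin 3)) (by positivity : (0 : ℝ) ≤ 3 * R),
    finrank_euclideanSpace_fin, ENNReal.mul_rpow_of_nonneg _ _ (by norm_num : (0 : ℝ) ≤ 2 / 3),
    ENNReal.ofReal_rpow_of_nonneg (by positivity) (by norm_num : (0 : ℝ) ≤ 2 / 3), ← mul_assoc,
    ← ENNReal.ofReal_mul (by positivity)]
  have h3 : ((3 * R) ^ 3 : ℝ) ^ (2 / 3 : ℝ) = (3 * R) ^ 2 := by
    rw [← Real.rpow_natCast (3 * R) 3, ← Real.rpow_mul (by positivity)]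
    norm_num
  rw [h3]
  congr 2
  field_simp
  ring

/-- **Exhaustion by balls**: `∫ F = sup_n ∫_{B(0,n+1)} F`. -/
theorem cutoffEnstrophy_lintegral_eq_iSup_ball (F : EuclideanSpace ℝ (Fin 3) → ℝ≥0∞) :
    ∫⁻ x, F x = ⨆ n : ℕ, ∫⁻ x in Metric.ball (0 : EuclideanSpace ℝ (Fin 3)) ((n : ℝ) + 1), F x := by
  have hmono : Monotone fun n : ℕ => Metric.ball (0 : EuclideanSpace ℝ (Fin 3)) ((n : ℝ) + 1) :=
    fun m n hmn => Metric.ball_subset_ball (by simpa using hmn)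
  rw [← setLIntegral_iUnion_of_directed F hmono.directed_le, Metric.iUnion_ball_nat_succ,
    Measure.restrict_univ]

/-- **Stub `stub_cutoffEnstrophy` (S5 of the r7 skeleton; statement and proof in the module
docstring).** -/
theorem stub_cutoffEnstrophy :
    ∃ c : ℝ, 0 < c ∧
      ∀ (f : ℕ → EuclideanSpace ℝ (Fin 3) → EuclideanSpace ℝ (Fin 3))
        (fl : EuclideanSpace ℝ (Fin 3) → EuclideanSpace ℝ (Fin 3)) (D D₆ : ℝ), 0 ≤ D → 0 ≤ D₆ →
        (∀ n, ContDiff ℝ 1 (f n)) → ContDiff ℝ 1 fl → (∀ n x, ‖f n x‖ ≤ 1) →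
        (∀ x, Tendsto (fun n => f n x) atTop (𝓝 (fl x))) →
        (∀ R : ℝ, 0 < R → ∀ᶠ n in atTop,
          (∫⁻ y in Metric.ball 0 R, ENNReal.ofReal (frobeniusNormSq (fderiv ℝ (f n) y))) ≤ ENNReal.ofReal D) →
        (∀ R : ℝ, 0 < R → ∀ᶠ n in atTop,
          (∫⁻ y in Metric.ball 0 R, ‖f n y‖ₑ ^ (6 : ℕ)) ≤ ENNReal.ofReal D₆) →
        ∫⁻ y, ENNReal.ofReal (frobeniusNormSq (fderiv ℝ fl y)) ≤ ENNReal.ofReal (2 * D + c * D₆ ^ (1 / 3 : ℝ)) := by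
  obtain ⟨C, hC0, hC⟩ := exists_norm_fderiv_cutoff_le (E := EuclideanSpace ℝ (Fin 3))
  obtain ⟨K, hK⟩ : ∃ K : ℝ≥0∞, K = ENNReal.ofReal (54 * C ^ 2) *
      volume (Metric.ball (0 : EuclideanSpace ℝ (Fin 3)) 1) ^ (2 / 3 : ℝ) := ⟨_, rfl⟩
  have hKtop : K ≠ ∞ := by
    rw [hK]
    exact ENNReal.mul_ne_top ENNReal.ofReal_ne_top
      (ENNReal.rpow_ne_top_of_nonneg (by norm_num) measure_ball_lt_top.ne)
  refine ⟨K.toReal + 1, by positivity, ?_⟩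
  intro f fl D D₆ hD hD₆ hf1 hfl hbd hconv hDloc hD6loc
  set M : ℝ := 2 * D + (K.toReal + 1) * D₆ ^ (1 / 3 : ℝ) with hM
  -- the uniform bound `2 D + K D₆^{1/3} ≤ M`
  have hKM : 2 * ENNReal.ofReal D + K * ENNReal.ofReal D₆ ^ (1 / 3 : ℝ) ≤ ENNReal.ofReal M := by
    rw [hM, ENNReal.ofReal_add (by positivity) (by positivity), ENNReal.ofReal_mul zero_le_two,
      ENNReal.ofReal_ofNat, ENNReal.ofReal_rpow_of_nonneg hD₆ (by norm_num)]
    refine add_le_add le_rfl ?_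
    calc K * ENNReal.ofReal (D₆ ^ (1 / 3 : ℝ))
        = ENNReal.ofReal K.toReal * ENNReal.ofReal (D₆ ^ (1 / 3 : ℝ)) := by
          rw [ENNReal.ofReal_toReal hKtop]
      _ = ENNReal.ofReal (K.toReal * D₆ ^ (1 / 3 : ℝ)) :=
          (ENNReal.ofReal_mul ENNReal.toReal_nonneg).symm
      _ ≤ ENNReal.ofReal ((K.toReal + 1) * D₆ ^ (1 / 3 : ℝ)) :=
          ENNReal.ofReal_le_ofReal
            (mul_le_mul_of_nonneg_right (by linarith) (Real.rpow_nonneg hD₆ _))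
  -- ### Step 1: the bound on every ball
  have hball : ∀ R : ℝ, 0 < R →
      ∫⁻ y in Metric.ball 0 R, ENNReal.ofReal (frobeniusNormSq (fderiv ℝ fl y)) ≤
        ENNReal.ofReal M := by
    intro R hR
    have h3R : (0 : ℝ) < 3 * R := by positivity
    obtain ⟨N, hN⟩ := eventually_atTop.1 ((hDloc (3 * R) h3R).and (hD6loc (3 * R) h3R))
    have key := lintegral_frobeniusNormSq_fderiv_le_of_tendsto_of_bound (C := 1) (D := M.toNNReal)
      (f := fun k x => cutoff R x • f (k + N) x) (fl := fun x => cutoff R x • fl x)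
      (fun k => (contDiff_cutoff R).smul (hf1 (k + N))) ((contDiff_cutoff R).smul hfl)
      (fun k x => by
        rw [norm_smul, Real.norm_of_nonneg (cutoff_nonneg R x)]
        exact mul_le_one₀ (cutoff_le_one R x) (norm_nonneg _) (hbd _ _))
      (fun x => ((hconv x).comp (tendsto_add_atTop_nat N)).const_smul (cutoff R x))
      (fun k => ?_)
    · calc ∫⁻ y in Metric.ball 0 R, ENNReal.ofReal (frobeniusNormSq (fderiv ℝ fl y))
          = ∫⁻ y in Metric.ball 0 R,
              ENNReal.ofReal (frobeniusNormSq (fderiv ℝ (fun x => cutoff R x • fl x) y)) :=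
            setLIntegral_congr_fun Metric.isOpen_ball.measurableSet fun y hy => by
              rw [cutoffEnstrophy_fderiv_smul_eq_of_mem_ball hR fl hy]
        _ ≤ ∫⁻ y, ENNReal.ofReal (frobeniusNormSq (fderiv ℝ (fun x => cutoff R x • fl x) y)) :=
            setLIntegral_le_lintegral _ _
        _ ≤ (M.toNNReal : ℝ≥0∞) := key
        _ = ENNReal.ofReal M := rfl
    · -- the uniform enstrophy bound of the cut-off tail fields
      have hk := hN (k + N) (Nat.le_add_left N k)
      calc ∫⁻ x, ENNReal.ofReal
              (frobeniusNormSq (fderiv ℝ (fun x => cutoff R x • f (k + N) x) x))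
          ≤ (2 * ∫⁻ x in Metric.ball 0 (3 * R),
                ENNReal.ofReal (frobeniusNormSq (fderiv ℝ (f (k + N)) x))) +
              ENNReal.ofReal (6 * (C / R) ^ 2) *
                ∫⁻ x in Metric.ball 0 (3 * R), ‖f (k + N) x‖ₑ ^ 2 :=
            cutoffEnstrophy_lintegral_fderiv_smul_le hR (hC R hR) (hf1 (k + N))
        _ ≤ 2 * ENNReal.ofReal D + ENNReal.ofReal (6 * (C / R) ^ 2) *
              (ENNReal.ofReal D₆ ^ (1 / 3 : ℝ) *
                volume (Metric.ball (0 : EuclideanSpace ℝ (Fin 3)) (3 * R)) ^ (2 / 3 : ℝ)) := by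
            refine add_le_add (mul_le_mul_right hk.1 _) (mul_le_mul_right ?_ _)
            calc ∫⁻ x in Metric.ball 0 (3 * R), ‖f (k + N) x‖ₑ ^ 2
                ≤ (∫⁻ x in Metric.ball 0 (3 * R), ‖f (k + N) x‖ₑ ^ 6) ^ (1 / 3 : ℝ) *
                    volume (Metric.ball (0 : EuclideanSpace ℝ (Fin 3)) (3 * R)) ^ (2 / 3 : ℝ) :=
                  cutoffEnstrophy_setLIntegral_enorm_sq_le _ (hf1 (k + N)).continuous
              _ ≤ _ := mul_le_mul_left (ENNReal.rpow_le_rpow hk.2 (by norm_num)) _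
        _ = 2 * ENNReal.ofReal D + K * ENNReal.ofReal D₆ ^ (1 / 3 : ℝ) := by
            rw [mul_comm (ENNReal.ofReal D₆ ^ (1 / 3 : ℝ)), ← mul_assoc,
              cutoffEnstrophy_const_eq C hR, hK]
        _ ≤ ENNReal.ofReal M := hKM
        _ = (M.toNNReal : ℝ≥0∞) := rfl
  -- ### Step 2: exhaustion `R → ∞`
  rw [cutoffEnstrophy_lintegral_eq_iSup_ball]
  exact iSup_le fun n => hball _ (by positivity)

end Summit.NavierStokesRegularity.NavierStokesRegularity.Theorems.RecordZoomAncient.Birth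

end
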